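import Literature.Analysis.FluidPDE.NSGalerkinStationary
import HarnessLib

/-!
# Steady Navier–Stokes on `T^d`: the stationary Galerkin approximations as vector fields

Trunk: FluidKinetic (`Literature/Analysis/FluidPDE`). Second step of the existence proof of
steady weak solutions of the forced Navier–Stokes equations on the flat torus by the Galerkin
method (Temam, *Navier–Stokes Equations* (1977/79), Ch. II, §1, Thm. 1.2, proof: the
approximate solutions `u_m` of (1.25), their energy equation (1.29) and the a priori bound
(1.30) `‖u_m‖ ≤ ν⁻¹‖f‖`; Constantin–Foias 1988, Ch. 8, (8.3)–(8.7)). The zeros of the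
Fourier–Galerkin field produced by `exists_galerkinRHS_eq_zero` (`NSGalerkinStationary`) on the
punctured frequency balls `S_N = {0 < |k|² ≤ N²}`, driven by the Fourier coefficients of a force
`f ∈ L²(T^d; ℝ^d)`, are turned into smooth divergence-free mean-zero trigonometric polynomials
`u_N = realTrigPoly S_N C_N` satisfying

* the **tested Galerkin equations** against every smooth divergence-free field `a` band-limited
  to `S_N`: `∫ (⟪u_N, (u_N·∇)a⟫ + ν ⟪u_N, Δa⟫ + ⟪f, a⟫) = 0`
  (`sum_re_inner_galerkinField_test`, the force term rewritten by Parseval);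
* the **energy equation** `ν ‖∇u_N‖² = ∫ ⟪f, u_N⟫` and the **uniform bounds**
  `(4π²ν)² ∑_{k} |k|² ‖C_N k‖² ≤ ∫ ‖f‖²`, whence `‖∇u_N‖² ≤ ‖f‖²_{L²}/(4π²ν²)` and
  `‖C_N k‖² ≤ ∫ ‖u_N‖² ≤ ‖f‖²_{L²}/(16π⁴ν²)`.

Everything is dimension independent. The passage to the limit `N → ∞` is in
`SteadyNavierStokesLimit` / `SteadyNavierStokesExistence`.

## Mathlib / tree search

Tree: `exists_galerkinRHS_eq_zero`, `galerkin_energy_eq_of_galerkinRHS_eq_zero`,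
`sum_freqNormSq_mul_norm_sq_le_of_galerkinRHS_eq_zero` (`NSGalerkinStationary`),
`sum_re_inner_galerkinField_test` (`NSGalerkinFourier`), `realTrigPoly`, `freqBall`,
`integral_inner_realTrigPoly_left`, `eGradNormSq_realTrigPoly`, `integral_norm_sq_realTrigPoly`
(`TorusTrigPoly`), `hasSum_re_inner_mFourierCoeff_complexify`,
`hasSum_sq_norm_mFourierCoeff_complexify` (`TorusVectorParseval`), `integral_mFourier`.

## References

* R. Temam, *Navier–Stokes Equations. Theory and Numerical Analysis*, North-Holland (1977;
  rev. ed. 1979), Ch. II, §1, Thm. 1.2 (proof, (1.25)–(1.30)). [Temam1979]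
* P. Constantin, C. Foias, *Navier–Stokes Equations*, Univ. Chicago Press (1988), Ch. 8,
  (8.3)–(8.7). [ConstantinFoias1988]
-/

open MeasureTheory Set Filter UnitAddTorus
open scoped ENNReal NNReal InnerProductSpace

noncomputable section

namespace Literature.Analysis.FluidPDE

section NS

open FunctionSpaces FunctionSpaces.Torus Torus

variable {d : Type*} [Fintype d] [DecidableEq d]

/-! ### The punctured frequency balls -/

/-- The punctured frequency ball `{k : 0 < |k|² ≤ N²}` is symmetric under `k ↦ -k`.
[folklore] -/
theorem neg_mem_freqBall_erase_zero {N : ℕ} :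
    ∀ k ∈ (freqBall (d := d) N).erase 0, -k ∈ (freqBall (d := d) N).erase 0 := by
  intro k hk
  rw [Finset.mem_erase] at hk ⊢
  exact ⟨neg_ne_zero.2 hk.1, neg_mem_freqBall_of_mem k hk.2⟩

omit [DecidableEq d] in
/-- A real trigonometric polynomial without mean mode has zero mean (`∫ e_k = 0` for `k ≠ 0`).
[folklore] -/
theorem hasZeroMean_realTrigPoly_of_zero_not_mem {S : Finset (d → ℤ)} (hS0 : (0 : d → ℤ) ∉ S)
    (C : (d → ℤ) → EuclideanSpace ℂ d) : HasZeroMean (realTrigPoly S C) := by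
  show ∫ x, EuclideanSpace.realPart (trigPoly S C x) = 0
  rw [EuclideanSpace.realPart.integral_comp_comm (continuous_trigPoly S C).integrable_unitAddTorus]
  have h : ∫ x, trigPoly S C x = 0 := by
    simp_rw [trigPoly_apply]
    have hint : ∀ k ∈ S, Integrable (fun x : UnitAddTorus d => mFourier k x • C k) volume :=
      fun k _ => ((mFourier k).continuous.smul continuous_const).integrable_unitAddTorus
    rw [integral_finsetSum _ hint]
    refine Finset.sum_eq_zero fun k hk => ?_
    have hk0 : k ≠ 0 := fun h => hS0 (h ▸ hk)
    rw [integral_smul_const, integral_mFourier, if_neg hk0, zero_smul]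
  rw [h, map_zero]

omit [DecidableEq d] in
/-- **Parseval against band-limited fields**: for a symmetric `S`, `f ∈ L²` and `a ∈ L²` with no
Fourier modes off `S`, the real trigonometric polynomial with the coefficients of `f` on `S`
pairs with `a` exactly like `f`: `∫ ⟪realTrigPoly S f̂, a⟫ = ∫ ⟪f, a⟫`. [folklore] -/
theorem integral_inner_realTrigPoly_mFourierCoeff_eq {S : Finset (d → ℤ)} (hS : ∀ k ∈ S, -k ∈ S)
    {f a : UnitAddTorus d → EuclideanSpace ℝ d} (hf : MemLp f 2 volume) (ha : MemLp a 2 volume)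
    (hband : ∀ k ∉ S, mFourierCoeff (EuclideanSpace.complexify ∘ a) k = 0) :
    ∫ x, ⟪realTrigPoly S (fun k => mFourierCoeff (EuclideanSpace.complexify ∘ f) k) x, a x⟫_ℝ =
      ∫ x, ⟪f x, a x⟫_ℝ := by
  rw [integral_inner_realTrigPoly_left hS (isConjSymm_mFourierCoeff (hf.integrable one_le_two)) ha]
  have h := hasSum_re_inner_mFourierCoeff_complexify hf ha
  have h' : HasSum (fun k : d → ℤ => (inner ℂ (mFourierCoeff (EuclideanSpace.complexify ∘ f) k)
      (mFourierCoeff (EuclideanSpace.complexify ∘ a) k)).re)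
      (∑ k ∈ S, (inner ℂ (mFourierCoeff (EuclideanSpace.complexify ∘ f) k)
        (mFourierCoeff (EuclideanSpace.complexify ∘ a) k)).re) :=
    hasSum_sum_of_ne_finset_zero fun k hk => by rw [hband k hk, inner_zero_right, Complex.zero_re]
  exact h'.unique h

/-! ### The stationary Galerkin approximations -/

/-- **The stationary Galerkin approximations of the steady Navier–Stokes problem**
(Temam 1979, Ch. II, §1, proof of Thm. 1.2: the approximate solutions `u_m` of (1.25), the
energy equation (1.29) and the a priori bound (1.30); Constantin–Foias 1988, Ch. 8,
(8.3)–(8.7)). Let `ν > 0`, `f ∈ L²(T^d; ℝ^d)` and `N ∈ ℕ`, and let `S = {0 < |k|² ≤ N²}`. There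
is a conjugate-symmetric, transversal coefficient family `C` supported in `S` (so that
`u = realTrigPoly S C` is a smooth, divergence-free, mean-zero real trigonometric polynomial)
such that
* `(4π²ν)² ∑_{k∈S} |k|² ‖C k‖² ≤ ∫ ‖f‖²` (a priori bound),
* `ν ‖∇u‖² = ∫ ⟪f, u⟫` (energy equation), and
* `∫ (⟪u, (u·∇)a⟫ + ν ⟪u, Δa⟫ + ⟪f, a⟫) = 0` for every smooth divergence-free `a` band-limited
  to `S` (the Galerkin equations `ν((u, a)) + b(u, u, a) = (f, a)` after integration by parts).
[cite: Temam1979, Ch. II Thm. 1.2 (proof, (1.25)–(1.30))] -/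
theorem exists_steady_galerkin_approx {ν : ℝ} (hν : 0 < ν)
    {f : UnitAddTorus d → EuclideanSpace ℝ d} (hf : MemLp f 2 volume) (N : ℕ) :
    ∃ C : (d → ℤ) → EuclideanSpace ℂ d,
      IsConjSymm C ∧ (∀ k, ∑ j, (k j : ℂ) * C k j = 0) ∧
      (∀ k ∉ (freqBall (d := d) N).erase 0, C k = 0) ∧
      (4 * Real.pi ^ 2 * ν) ^ 2 *
          (∑ k ∈ (freqBall (d := d) N).erase 0, freqNormSq k * ‖C k‖ ^ 2) ≤ ∫ x, ‖f x‖ ^ 2 ∧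
      ν * (eGradNormSq (realTrigPoly ((freqBall (d := d) N).erase 0) C)).toReal =
          ∫ x, ⟪f x, realTrigPoly ((freqBall (d := d) N).erase 0) C x⟫_ℝ ∧
      ∀ a : UnitAddTorus d → EuclideanSpace ℝ d, IsSmooth a → IsDivFree a →
        (∀ k ∉ (freqBall (d := d) N).erase 0, mFourierCoeff (EuclideanSpace.complexify ∘ a) k = 0) →
        ∫ x, (⟪realTrigPoly ((freqBall (d := d) N).erase 0) C x,
            FunctionSpaces.Torus.convect (realTrigPoly ((freqBall (d := d) N).erase 0) C) a x⟫_ℝ +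
          ν * ⟪realTrigPoly ((freqBall (d := d) N).erase 0) C x, FunctionSpaces.Torus.laplacian a x⟫_ℝ +
          ⟪f x, a x⟫_ℝ) = 0 := by
  set S : Finset (d → ℤ) := (freqBall (d := d) N).erase 0 with hSdef
  have hS : ∀ k ∈ S, -k ∈ S := neg_mem_freqBall_erase_zero
  have hS0 : (0 : d → ℤ) ∉ S := by simp [hSdef]
  have hfi : Integrable f volume := hf.integrable one_le_two
  set g : ↥S → EuclideanSpace ℂ d := fun k =>
    mFourierCoeff (EuclideanSpace.complexify ∘ f) (k : d → ℤ) with hgdef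
  have hgr : IsRealCoeff g := isRealCoeff_mFourierCoeff hfi
  obtain ⟨c, hc, h0⟩ := exists_galerkinRHS_eq_zero hν hS hS0 hgr
  have hCsymm : IsConjSymm (coeffExt S c) := hc.1.isConjSymm_coeffExt hS
  have hCT : IsTransversal S (coeffExt S c) := hc.2.isTransversal_coeffExt
  have hGg : realTrigPoly S (coeffExt S g) =
      realTrigPoly S fun k => mFourierCoeff (EuclideanSpace.complexify ∘ f) k :=
    realTrigPoly_coeffExt_restrict _
  refine ⟨coeffExt S c, hCsymm, ?_, fun k hk => coeffExt_of_not_mem c hk, ?_, ?_, ?_⟩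
  · intro k
    by_cases hk : k ∈ S
    · exact hCT k hk
    · simp [coeffExt_of_not_mem c hk]
  · -- a priori bound
    have h1 := sum_freqNormSq_mul_norm_sq_le_of_galerkinRHS_eq_zero hν hS hS0 hgr hc h0
    rw [← sum_coeffExt (fun k v => freqNormSq k * ‖v‖ ^ 2) c] at h1
    refine h1.trans ?_
    calc ∑ k : ↥S, ‖g k‖ ^ 2
        = ∑ k ∈ S, ‖mFourierCoeff (EuclideanSpace.complexify ∘ f) k‖ ^ 2 :=
          Finset.sum_coe_sort S fun k => ‖mFourierCoeff (EuclideanSpace.complexify ∘ f) k‖ ^ 2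
      _ ≤ ∫ x, ‖f x‖ ^ 2 :=
          sum_le_hasSum S (fun k _ => sq_nonneg _) (hasSum_sq_norm_mFourierCoeff_complexify hf)
  · -- energy equation
    rw [galerkin_energy_eq_of_galerkinRHS_eq_zero ν hS hgr hc h0, hGg]
    exact integral_inner_realTrigPoly_mFourierCoeff_eq hS hf (memLp_realTrigPoly S _ 2)
      fun k hk => mFourierCoeff_realTrigPoly_eq_zero hS hCsymm hk
  · -- the tested Galerkin equations
    intro a ha hdiv hband
    have hid := sum_re_inner_galerkinField_test ν hS (hgr.isConjSymm_coeffExt hS) hCsymm hCT ha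
      hdiv hband
    have hzero : ∑ k ∈ S, (inner ℂ (galerkinField ν S (coeffExt S g) (coeffExt S c) k)
        (mFourierCoeff (EuclideanSpace.complexify ∘ a) k)).re = 0 := by
      refine Finset.sum_eq_zero fun k hk => ?_
      have hk0 : galerkinField ν S (coeffExt S g) (coeffExt S c) k = 0 := by
        have := congrFun h0 ⟨k, hk⟩
        rwa [galerkinRHS_apply] at this
      rw [hk0, inner_zero_left, Complex.zero_re]
    rw [hzero, hGg] at hid
    -- split off the force term and rewrite it by Parseval
    have hu : IsSmooth (realTrigPoly S (coeffExt S c)) := isSmooth_realTrigPoly _ _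
    have hGs : IsSmooth (realTrigPoly S fun k => mFourierCoeff (EuclideanSpace.complexify ∘ f) k) :=
      isSmooth_realTrigPoly _ _
    have i1 : Integrable (fun x => ⟪realTrigPoly S (coeffExt S c) x,
        FunctionSpaces.Torus.convect (realTrigPoly S (coeffExt S c)) a x⟫_ℝ +
        ν * ⟪realTrigPoly S (coeffExt S c) x, FunctionSpaces.Torus.laplacian a x⟫_ℝ) volume :=
      ((hu.continuous.inner (hu.convect ha).continuous).add
        ((hu.continuous.inner ha.laplacian.continuous).const_smul ν)).integrable_unitAddTorus
    have i2 : Integrable (fun x => ⟪realTrigPoly S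
        (fun k => mFourierCoeff (EuclideanSpace.complexify ∘ f) k) x, a x⟫_ℝ) volume :=
      (hGs.continuous.inner ha.continuous).integrable_unitAddTorus
    have i3 : Integrable (fun x => ⟪f x, a x⟫_ℝ) volume :=
      integrable_inner_of_continuous hfi ha.continuous
    have hforce := integral_inner_realTrigPoly_mFourierCoeff_eq hS hf (ha.continuous.memLp_of_hasCompactSupport
      (HasCompactSupport.of_compactSpace _)) hband
    rw [integral_add i1 i2, hforce, ← integral_add i1 i3] at hid
    exact hid.symm

/-- **Uniform bounds for the stationary Galerkin approximations** (consequences of the a priori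
bound of `exists_steady_galerkin_approx`; Temam 1979, Ch. II, (1.30)): with
`Λ = (∫ ‖f‖²)/(4π²ν)²`, a conjugate-symmetric family `C` supported in the punctured ball `S`
with `(4π²ν)² ∑_{k∈S} |k|² ‖C k‖² ≤ ∫ ‖f‖²` satisfies `‖∇u‖² ≤ 4π² Λ`, `∫ ‖u‖² ≤ Λ` and
`‖C k‖² ≤ Λ` for `u = realTrigPoly S C`. [folklore] -/
theorem steady_galerkin_bounds {ν : ℝ} (hν : 0 < ν) {f : UnitAddTorus d → EuclideanSpace ℝ d}
    {N : ℕ} {C : (d → ℤ) → EuclideanSpace ℂ d} (hC : IsConjSymm C)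
    (hsupp : ∀ k ∉ (freqBall (d := d) N).erase 0, C k = 0)
    (hbound : (4 * Real.pi ^ 2 * ν) ^ 2 *
      (∑ k ∈ (freqBall (d := d) N).erase 0, freqNormSq k * ‖C k‖ ^ 2) ≤ ∫ x, ‖f x‖ ^ 2) :
    eGradNormSq (realTrigPoly ((freqBall (d := d) N).erase 0) C) ≤
        ENNReal.ofReal (4 * Real.pi ^ 2 * ((∫ x, ‖f x‖ ^ 2) / (4 * Real.pi ^ 2 * ν) ^ 2)) ∧
      ∫ x, ‖realTrigPoly ((freqBall (d := d) N).erase 0) C x‖ ^ 2 ≤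
        (∫ x, ‖f x‖ ^ 2) / (4 * Real.pi ^ 2 * ν) ^ 2 ∧
      ∀ k, ‖C k‖ ^ 2 ≤ (∫ x, ‖f x‖ ^ 2) / (4 * Real.pi ^ 2 * ν) ^ 2 := by
  set S : Finset (d → ℤ) := (freqBall (d := d) N).erase 0 with hSdef
  have hS : ∀ k ∈ S, -k ∈ S := neg_mem_freqBall_erase_zero
  have hS0 : (0 : d → ℤ) ∉ S := by simp [hSdef]
  have hden : 0 < (4 * Real.pi ^ 2 * ν) ^ 2 := by positivity
  have hE : ∑ k ∈ S, freqNormSq k * ‖C k‖ ^ 2 ≤ (∫ x, ‖f x‖ ^ 2) / (4 * Real.pi ^ 2 * ν) ^ 2 := by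
    rw [le_div_iff₀ hden, mul_comm]
    exact hbound
  have hb : ∑ k ∈ S, ‖C k‖ ^ 2 ≤ ∑ k ∈ S, freqNormSq k * ‖C k‖ ^ 2 := by
    have h := sum_norm_sq_le_sum_freqNormSq_mul hS0 (fun k : ↥S => C k)
    rwa [← Finset.sum_coe_sort S (fun k => ‖C k‖ ^ 2),
      ← Finset.sum_coe_sort S (fun k => freqNormSq k * ‖C k‖ ^ 2)]
  refine ⟨?_, ?_, fun k => ?_⟩
  · rw [eGradNormSq_realTrigPoly hS hC]
    exact ENNReal.ofReal_le_ofReal (mul_le_mul_of_nonneg_left hE (by positivity))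
  · rw [integral_norm_sq_realTrigPoly hS hC]
    exact hb.trans hE
  · by_cases hk : k ∈ S
    · exact ((Finset.single_le_sum (f := fun k => ‖C k‖ ^ 2) (fun k _ => sq_nonneg _) hk).trans
        hb).trans hE
    · rw [hsupp k hk, norm_zero, zero_pow two_ne_zero]
      positivity

end NS

end Literature.Analysis.FluidPDE
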